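import Summits.BirchSwinnertonDyer.BirchSwinnertonDyer.Theorems.SignedLowerHalvesSharpFlatCharValueRankZeroAllLevelsOfPoitouTate
import Summits.BirchSwinnertonDyer.BirchSwinnertonDyer.Theorems.SchneiderFreeAdditiveX3PoitouTateSelmerDualityHolds
import HarnessLib

set_option linter.dupNamespace false -- `…BirchSwinnertonDyer.BirchSwinnertonDyer…` is the cell's nested layout (D-0017)
set_option autoImplicit false

/-!
# F16 (Sprung 2024 Lemma 5.9 at all levels, item 19878) and the ♯/♭ count ⟸ the SINGLE Poitou–Tate row PT-Ш(ℚ) — PT-Sel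
# discharged (LADDER-BSD D-0154 (2), INPUTS-LIST-2 ADDENDUM-9 §0.11 entry T13, SignedLowerHalves half)

Seat `bsd-inputs-honda-p1` (gen 6, idle INPUTS prover of the desk `pub/bsd-wall/bsd-inputs`), `--supports`
stmt-BirchSwinnertonDyer-19878. THEOREMS ONLY (no definition, no named fact, no `sorry`); pure re-export, no new mathematics.

T1 (`Theorems/SignedLowerHalvesSharpFlatCharValueRankZeroAllLevelsOfPoitouTate.lean`, l55-p1 g2, p618145) proved the doors
`SharpFlatCount.lem55AllN_of_poitouTate` / `lem59AllN_of_poitouTate` / `lem59_of_poitouTate` /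
`sharpFlatCharValueRankZeroAllLevels_of_poitouTate`, each `(hPTs : poitouTate_selmerStructure_duality ℚ) (hPT : poitouTate_sha_tateDual ℚ)`.
Since 2026-08-28T10:27Z the first row is a THEOREM OF THE TREE:
`SchneiderFreeAdditiveX3.PoitouTateReduction.poitouTate_selmerStructure_duality_holds (K)` (cell `bsd-schneider`, door-c4 g18, p624636;
item 20461 closed by p625477). This file substitutes it: F16 and the route declaration `SignedLowerHalves.SharpFlatCharValueRankZeroAllLevels`
now follow from PT-Ш(ℚ) ALONE (`poitouTate_sha_tateDual ℚ`, item 20462 — still OPEN).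

Honest framing: CONDITIONAL on the one remaining named fact PT-Ш(ℚ); item 19878 is NOT closed (one-liner the day 20462 has a `_holds`);
no crux and no summit statement is proved; BSD is not proved by any of this.
References: [Sprung2024, Lemmas 5.5, 5.9, Props. 7.3, 7.6]; [GreenbergLNM1716] Prop. 4.13; [MilneADT2006] Ch. I, Thm. 4.10.
-/

noncomputable section

namespace Summit.BirchSwinnertonDyer.BirchSwinnertonDyer.Theorems.SharpFlatCount

open Literature.NumberTheory.GaloisCohomology Literature.NumberTheory.EllipticCurves

/-- **Sprung 2024 Lemma 5.5 at all levels, cardinality form (`Sprung2024.lem55AllN_sharpFlat_coinvariants_card`) ⟸ PT-Ш(ℚ) ALONE**: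
`lem55AllN_of_poitouTate` with its PT-Sel row discharged by `SchneiderFreeAdditiveX3.PoitouTateReduction.poitouTate_selmerStructure_duality_holds ℚ`.
Conditional on `poitouTate_sha_tateDual ℚ`; closes nothing; BSD is not proved by this. [cite: Sprung2024, Lemma 5.5]
[cite: MilneADT2006, Ch. I, Thm. 4.10] -/
theorem lem55AllN_of_poitouTateSha (hPT : poitouTate_sha_tateDual ℚ) : Sprung2024.lem55AllN_sharpFlat_coinvariants_card :=
  lem55AllN_of_poitouTate (SchneiderFreeAdditiveX3.PoitouTateReduction.poitouTate_selmerStructure_duality_holds ℚ) hPT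

/-- **F16 = Sprung 2024 Lemma 5.9 at all levels (`Sprung2024.lem59AllN_sharpFlatCharValue_rankZero`, item 19878's signature) ⟸ PT-Ш(ℚ)
ALONE.** Conditional on `poitouTate_sha_tateDual ℚ` (item 20462); closes nothing; BSD is not proved by this. [cite: Sprung2024, Lemma 5.9]
[cite: MilneADT2006, Ch. I, Thm. 4.10] -/
theorem lem59AllN_of_poitouTateSha (hPT : poitouTate_sha_tateDual ℚ) : Sprung2024.lem59AllN_sharpFlatCharValue_rankZero :=
  lem59AllN_of_poitouTate (SchneiderFreeAdditiveX3.PoitouTateReduction.poitouTate_selmerStructure_duality_holds ℚ) hPT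

/-- **Sprung 2024 Lemma 5.9, top level (`Sprung2024.lem59_sharpFlatCharValue_rankZero`) ⟸ PT-Ш(ℚ) ALONE.** Conditional; closes
nothing; BSD is not proved by this. [cite: Sprung2024, Lemma 5.9] [cite: MilneADT2006, Ch. I, Thm. 4.10] -/
theorem lem59_of_poitouTateSha (hPT : poitouTate_sha_tateDual ℚ) : Sprung2024.lem59_sharpFlatCharValue_rankZero :=
  lem59_of_poitouTate (SchneiderFreeAdditiveX3.PoitouTateReduction.poitouTate_selmerStructure_duality_holds ℚ) hPT

/-- **Route `SignedLowerHalves`, support `SharpFlatCharValueRankZeroAllLevels` (item 19878) ⟸ PT-Ш(ℚ) alone.** Conditional; the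
item is not closed; BSD is not proved by this. [cite: Sprung2024, Lemma 5.9] [cite: MilneADT2006, Ch. I, Thm. 4.10] -/
theorem sharpFlatCharValueRankZeroAllLevels_of_poitouTateSha (hPT : poitouTate_sha_tateDual ℚ) :
    Summit.BirchSwinnertonDyer.BirchSwinnertonDyer.Theses.SignedLowerHalves.SharpFlatCharValueRankZeroAllLevels :=
  lem59AllN_of_poitouTateSha hPT

/-! ## Appendix (INPUTS-LIST-2 ADD-10 §A T13a, plan-2 g10 texts verbatim): the closers-in-waiting on the text of item 20462 -/

/-- **Lemma 5.9 all-`N` from the text of item stmt-BirchSwinnertonDyer-20462 `PoitouTateShaTateDualFact` VERBATIM** (`∀ K,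
poitouTate_sha_tateDual K`, specialised at `K = ℚ`). CONDITIONAL. [cite: Sprung2024, §5.2 (pp. 39–41)] [cite: MilneADT2006, Ch. I, Thm. 4.10 (a)] -/
theorem lem59AllN_of_poitouTateShaFact
    (hPT : ∀ (K : Type) [Field K] [NumberField K], poitouTate_sha_tateDual K) :
    Sprung2024.lem59AllN_sharpFlatCharValue_rankZero :=
  lem59AllN_of_poitouTateSha (hPT ℚ)

/-- **Route `SignedLowerHalves`, item 19878 BY NAME ⟸ the text of item 20462 VERBATIM** (the closer-in-waiting: the day 20462 is
discharged, `SharpFlatCharValueRankZeroAllLevels_proof := sharpFlatCharValueRankZeroAllLevels_of_poitouTateShaFact ‹20462›`).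
CONDITIONAL; does NOT close the item. [cite: Sprung2024, §5.2 (pp. 39–41)] [cite: MilneADT2006, Ch. I, Thm. 4.10 (a)] -/
theorem sharpFlatCharValueRankZeroAllLevels_of_poitouTateShaFact
    (hPT : ∀ (K : Type) [Field K] [NumberField K], poitouTate_sha_tateDual K) :
    Summit.BirchSwinnertonDyer.BirchSwinnertonDyer.Theses.SignedLowerHalves.SharpFlatCharValueRankZeroAllLevels :=
  lem59AllN_of_poitouTateSha (hPT ℚ)

end Summit.BirchSwinnertonDyer.BirchSwinnertonDyer.Theorems.SharpFlatCount

end
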